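import Mathlib.NumberTheory.Chebyshev
import Mathlib.NumberTheory.ArithmeticFunction.Misc
import Mathlib.NumberTheory.ArithmeticFunction.VonMangoldt
import Literature.NumberTheory.LFunctions.RosserSchoenfeldMertensFirstProofs
import Literature.NumberTheory.LFunctions.ChebyshevSylvesterPsi
import HarnessLib

/-!
# Stub `stub_helsonG` of line `Sketch` for crux `WeilComb.CombShapePositivity` — Chebyshev–Stirling proof
(item stmt-RiemannHypothesis-11229, route route-RiemannHypothesis-WeilComb; siege attempt k3)

The Helson potential bound with constant `39/50`: for every `M` and `a : ℕ → ℂ`,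

`Σ_{m ≤ M} ‖a_m‖² (log m + ψ₁(M/m)) ≤ (log M + 39/50) Σ_{m ≤ M} ‖a_m‖²`, `ψ₁(y) = Σ_{n ≤ y} Λ(n)/n`.

This file gives a second, structurally independent proof of the registered stub (the line's own
copy, `…Theorems.WeilCombBohrFejer.stub_helsonG`, goes through Rosser–Schoenfeld (3.24) and the
numerical constant `Σ_p (log p)/(p(p−1)) ≤ 0.7724`). Here no prime-by-prime numerics are needed:

* Chebyshev's identity `Σ_{n ≤ N} Λ(n) ⌊N/n⌋ = log N!` (Mathlib: `Λ * ζ = log` summed over `n ≤ N`,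
  `ArithmeticFunction.sum_Ioc_mul_zeta_eq_sum`);
* `⌊N/n⌋ ≥ (N+1)/n − 1`, whence `(N+1) Σ_{n ≤ N} Λ(n)/n ≤ log N! + ψ(N)`;
* Stirling, `log N! ≤ N log N − N + (log N)/2 + 1` (`RosserSchoenfeld324.log_factorial_le`);
* a crude Chebyshev bound `ψ(N) ≤ 1.15 N` (the tree's `ψ ≤ 1.04 x` on `[0, 10⁴]`,
  `SchoenfeldBound.psi_le_of_le_ten_thousand`, and Sylvester's `ψ ≤ 1.0722 x + 7 √x` beyond,
  `psi_le_sylvester`);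
* so `(N+1) Σ_{n ≤ N} Λ(n)/n ≤ N log N + (log N)/2 + 1 + 0.15 N ≤ (N+1)(log N + 39/50)` for `N ≥ 1`
  (the slack is `0.63 N + (log N)/2 − 0.22 ≥ 0`), i.e. `Σ_{n ≤ N} Λ(n)/n ≤ log N + 39/50`;
* termwise in `m`: `log m + log ⌊M/m⌋ ≤ log M`.

(The true constant is `−γ + o(1)` asymptotically and `≤ 0` throughout; `39/50` is what the line's
budget `stub_assemble40` consumes.)
-/

noncomputable section

-- the sub-problem path RiemannHypothesis/RiemannHypothesis duplicates a namespace (D-0017)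
set_option linter.dupNamespace false

open scoped BigOperators Chebyshev

namespace Summit.RiemannHypothesis.RiemannHypothesis.Theorems.WeilCombHelsonGK3

open Literature.NumberTheory.LFunctions

/-- `Σ_{1 ≤ n ≤ N} log n = log N!`. [folklore] -/
theorem sum_log_eq_log_factorial (N : ℕ) :
    ∑ n ∈ Finset.Ioc 0 N, Real.log n = Real.log (N.factorial : ℝ) := by
  induction N with
  | zero => simp
  | succ k ih =>
    rw [Finset.sum_Ioc_succ_top (Nat.zero_le k), ih, Nat.factorial_succ, Nat.cast_mul,
      Real.log_mul (by positivity) (by positivity)]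
    ring

/-- Chebyshev's identity `Σ_{n ≤ N} Λ(n) ⌊N/n⌋ = log N!` (`Λ * ζ = log`, summed over `n ≤ N`).
[folklore] -/
theorem sum_vonMangoldt_mul_div_eq_log_factorial (N : ℕ) :
    ∑ n ∈ Finset.Ioc 0 N, ArithmeticFunction.vonMangoldt n * ((N / n : ℕ) : ℝ) =
      Real.log (N.factorial : ℝ) := by
  have h := ArithmeticFunction.sum_Ioc_mul_zeta_eq_sum ArithmeticFunction.vonMangoldt N
  rw [ArithmeticFunction.vonMangoldt_mul_zeta] at h
  rw [← h, ← sum_log_eq_log_factorial]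
  exact Finset.sum_congr rfl fun n _ ↦ ArithmeticFunction.log_apply

/-- `(N+1) Σ_{n ≤ N} Λ(n)/n ≤ log N! + ψ(N)` (from `(N+1)/n − 1 ≤ ⌊N/n⌋` and Chebyshev's identity).
[folklore] -/
theorem succ_mul_sum_vonMangoldt_div_le (N : ℕ) :
    ((N : ℝ) + 1) * ∑ n ∈ Finset.Ioc 0 N, ArithmeticFunction.vonMangoldt n / n ≤
      Real.log (N.factorial : ℝ) + ψ (N : ℝ) := by
  rw [Chebyshev.psi, Nat.floor_natCast, ← sum_vonMangoldt_mul_div_eq_log_factorial,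
    ← Finset.sum_add_distrib, Finset.mul_sum]
  refine Finset.sum_le_sum fun n hn ↦ ?_
  have hn0 : 0 < n := (Finset.mem_Ioc.1 hn).1
  have hfl := RosserSchoenfeld324.sub_one_le_natDiv N n hn0
  have hΛ : 0 ≤ ArithmeticFunction.vonMangoldt n := ArithmeticFunction.vonMangoldt_nonneg
  calc ((N : ℝ) + 1) * (ArithmeticFunction.vonMangoldt n / n)
      = ArithmeticFunction.vonMangoldt n * (((N : ℝ) + 1) / n - 1) +
          ArithmeticFunction.vonMangoldt n := by ring
    _ ≤ ArithmeticFunction.vonMangoldt n * ((N / n : ℕ) : ℝ) +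
          ArithmeticFunction.vonMangoldt n := by gcongr

/-- A crude Chebyshev bound: `ψ(N) ≤ 1.15 N` (`ψ ≤ 1.04 x` on `[0, 10⁴]`, Sylvester's
`ψ ≤ 1.0722 x + 7 √x` with `√x ≤ x/100` beyond). [folklore] -/
theorem psi_natCast_le (N : ℕ) : ψ (N : ℝ) ≤ 1.15 * N := by
  have hN : (0 : ℝ) ≤ N := Nat.cast_nonneg N
  rcases le_or_gt (N : ℝ) 10000 with h | h
  · have := SchoenfeldBound.psi_le_of_le_ten_thousand hN h
    linarith
  · have h1 := psi_le_sylvester hN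
    have hs : Real.sqrt N ≤ N / 100 := by
      rw [Real.sqrt_le_iff]
      exact ⟨by positivity, by nlinarith⟩
    linarith

/-- **Mertens-type upper bound `Σ_{n ≤ N} Λ(n)/n ≤ log N + 39/50`** for every natural `N ≥ 1`
(Chebyshev's identity, Stirling, `ψ(N) ≤ 1.15 N`). [folklore] -/
theorem sum_vonMangoldt_div_le (N : ℕ) (hN : 1 ≤ N) :
    ∑ n ∈ Finset.Icc 1 N, ArithmeticFunction.vonMangoldt n / n ≤ Real.log N + 39 / 50 := by
  have hI : Finset.Icc 1 N = Finset.Ioc 0 N := by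
    ext n
    simp only [Finset.mem_Icc, Finset.mem_Ioc]
    omega
  rw [hI]
  have h1 := succ_mul_sum_vonMangoldt_div_le N
  have h2 := RosserSchoenfeld324.log_factorial_le N hN
  have h3 := psi_natCast_le N
  have hN' : (1 : ℝ) ≤ N := by exact_mod_cast hN
  have hlog : 0 ≤ Real.log N := Real.log_nonneg hN'
  have hpos : (0 : ℝ) < (N : ℝ) + 1 := by linarith
  refine le_of_mul_le_mul_left ?_ hpos
  have key : ((N : ℝ) + 1) * ∑ n ∈ Finset.Ioc 0 N, ArithmeticFunction.vonMangoldt n / n ≤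
      N * Real.log N - N + Real.log N / 2 + 1 + 1.15 * N := by linarith
  have hslack : N * Real.log N - N + Real.log N / 2 + 1 + 1.15 * N ≤
      ((N : ℝ) + 1) * (Real.log N + 39 / 50) := by nlinarith
  exact key.trans hslack

/-- The row bound of the Helson potential: for `1 ≤ m ≤ M`,
`log m + Σ_{n ≤ M/m} Λ(n)/n ≤ log M + 39/50` (`log m + log ⌊M/m⌋ ≤ log M`). [folklore] -/
theorem log_add_sum_vonMangoldt_div_le {M m : ℕ} (hm : m ∈ Finset.Icc 1 M) :
    Real.log m + ∑ n ∈ Finset.Icc 1 (M / m), (ArithmeticFunction.vonMangoldt n : ℝ) / n ≤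
      Real.log M + 39 / 50 := by
  obtain ⟨hm1, hmM⟩ := Finset.mem_Icc.1 hm
  have hq : 1 ≤ M / m := (Nat.le_div_iff_mul_le hm1).2 (by simpa using hmM)
  have h := sum_vonMangoldt_div_le (M / m) hq
  have hm0 : (0 : ℝ) < m := by exact_mod_cast hm1
  have hq0 : (0 : ℝ) < ((M / m : ℕ) : ℝ) := by exact_mod_cast hq
  have hprod : (m : ℝ) * ((M / m : ℕ) : ℝ) ≤ M := by exact_mod_cast Nat.mul_div_le M m
  have hlog : Real.log m + Real.log ((M / m : ℕ) : ℝ) ≤ Real.log M := by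
    rw [← Real.log_mul hm0.ne' hq0.ne']
    exact Real.log_le_log (by positivity) hprod
  linarith

/-- **Stub S4 (`stub_helsonG`) — Helson potential with the constant `39/50`.** For every `M`, `a`:
`Σ_m ‖a_m‖² (log m + ψ₁(M/m)) ≤ (log M + 39/50) Σ ‖a_m‖²`, `ψ₁(y) = Σ_{n ≤ y} Λ(n)/n`
(termwise from `log_add_sum_vonMangoldt_div_le`). Independent Chebyshev–Stirling proof of the
stub registered for line `Sketch` of crux stmt-RiemannHypothesis-11229. [folklore] -/
theorem stub_helsonG : ∀ (M : ℕ) (a : ℕ → ℂ),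
    ∑ m ∈ Finset.Icc 1 M, ‖a m‖ ^ 2 *
        (Real.log m + ∑ n ∈ Finset.Icc 1 (M / m), (ArithmeticFunction.vonMangoldt n : ℝ) / n) ≤
      (Real.log M + 39 / 50) * ∑ m ∈ Finset.Icc 1 M, ‖a m‖ ^ 2 := by
  intro M a
  rw [Finset.mul_sum]
  refine Finset.sum_le_sum fun m hm ↦ ?_
  rw [mul_comm (Real.log M + 39 / 50)]
  exact mul_le_mul_of_nonneg_left (log_add_sum_vonMangoldt_div_le hm) (by positivity)

end Summit.RiemannHypothesis.RiemannHypothesis.Theorems.WeilCombHelsonGK3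

end
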